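import Summits.QuantumFields.YangMills.Theorems.F4SubCurvatureDoorShortRootRigidityOddModeHarmonicProjection
import Summits.QuantumFields.YangMills.Theorems.F4SubCurvatureDoorShortRootRigidityOddModePlaneFrame
import Summits.QuantumFields.YangMills.Theorems.F4SubCurvatureDoorFibreDichotomySphereRadiality
import Summits.QuantumFields.YangMills.Theorems.F4SubCurvatureDoorMirrorAnalyticityRegistered
import Mathlib
import HarnessLib

/-!
# OddModeRigidity / R-O1 «ANALYTIC HALF» — the composition, unfolded (no Cruxes definitions)

Crux ⟨stmt-QuantumFields-23035⟩ `F4SubCurvatureDoor.ShortRootRigidity`, stub `:146 stub_oddModeRigidity`, typed split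
`Cruxes/ShortRootRigidity/Lines/odd_mode_split.lean` (ym-idea-3 g21/g22): `AnalyticHalf := (∀ L, NoBadModes L) → OddModeRigidity`.

`isometry_invariant_of_noBadModes` proves exactly this with the Cruxes vocabulary unfolded (`pev h = toFun h`,
`Σ ∂ᵢ∂ᵢ h = lap h`); `isometry_invariant_of_noBadModes_family` is the same for an ARBITRARY symmetry family `𝒢` and
`isometry_invariant_of_noBadModes_F4` passes the full class symmetry (signed permutations + `D₄`-preserving isometries) down: if every harmonic homogeneous polynomial that is signed-permutation invariant and even-part slice-invariant is
`O(4)`-invariant, then every kernel `K` continuous off the origin, signed-permutation invariant and even-part slice-invariant satisfies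
`K (R x) = K x` for every linear isometry `R`.  No analyticity is used.

PROOF.  Fix `R`, `x ≠ 0`, and put `F := K∘R − K`.  For a shell `S = {a<‖x‖<b}` and a degree `L` let `v ∈ Harm_L` be the shell projection of
`K` (✓`exists_harmonicProjection`).  Projection is isometry-equivariant (✓`harmonicProjection_comp_iso`) and unique
(✓`eq_zero_of_shell_orthogonal`), so `v` inherits signed-permutation invariance (✓`harmonicProjection_invariant`) and the even-part slice
identity — which is a pointwise linear identity among `K∘T` for three isometries `T` (✓`evenPartSliceInvariant_pointwise`).  By the
hypothesis `v∘A = v` for every isometry `A`; hence `∫_S q·(K∘R) = ∫_S q·(v∘R) = ∫_S q·v = ∫_S q·K` for all `q ∈ Harm_L`: every shell moment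
of `F` against every harmonic homogeneous polynomial vanishes.  Therefore (✓`sphere_moment_eq_zero_of_shell_integrals`,
✓`const_on_sphere_of_orthogonal_harmonics`, and the degree-`0` moment for the mean) `F` vanishes on the sphere through `x`.

Mathlib + tree only; no `sorry`; no definitions.  HONEST LABEL: this is the piece `AnalyticHalf` of the three-way split of the OPEN stub
`:146` (the other two, `TorusReduction` and `TrigonalInjectivityAll`, are not touched); `OddModeRigidity`, ⟨23035⟩, ⟨23125⟩, R2d and the
Yang–Mills mass gap remain OPEN; no summit is proved by a line.  Seat `ym-line-frs-p2` g16 (cell ym-idea-3, free hands).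
-/

noncomputable section

open MeasureTheory MeasureTheory.Measure Set Function Filter Topology Metric
open scoped BigOperators

namespace Summit.QuantumFields.YangMills.Theorems.F4SubCurvatureDoorAnalyticHalfProof

open MvPolynomial (aeval X C)
open Literature.Analysis.Calculus.MvPoly (toFun lap lap_add lap_smul contDiff_toFun toFun_mul toFun_add toFun_smul toFun_zero toFun_C
  lap_eq_zero_of_isHomogeneous_le_one)
open Summit.QuantumFields.YangMills.Cruxes.OSLegsAtWeakCouplingC.Sketch (IsSignedPerm)
open Literature.MathematicalPhysics.QuantumLattice (siteToE)
open Summit.QuantumFields.YangMills.Theorems.F4SubCurvatureDoorMirrorAnalyticityRegistered (E4)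
open Summit.QuantumFields.YangMills.Theorems.F4SubCurvatureDoorSliceDensityRegistered (E2 planeEmb perpEmb EvenPartSliceInvariant)
open Summit.QuantumFields.YangMills.Theorems.F4SubCurvatureDoorHarmonicMomentODE (toFun_aevalIso isHomogeneous_aevalIso
  lap_aevalIso_eq_zero integrableOn_shell sphere_moment_eq_zero_of_shell_integrals const_on_sphere_of_orthogonal_harmonics
  sphere_measure_toReal_pos)

/-! ## Transfer of a four-term isometry identity to the projection -/

/-- **Linear isometry identities pass to the harmonic projection.**  If `v ∈ Harm_L` is the shell projection of `g` (continuous off `0`)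
and `g (T₁ z) + g (T₂ z) = g z + g (T₃ z)` for all `z` (three linear isometries), then the same identity holds for `toFun v`. -/
theorem harmonicProjection_identity {g : E4 → ℝ} (hgc : ContinuousOn g {0}ᶜ) {a b : ℝ} (ha : 0 < a) (hab : a < b) {L : ℕ}
    {v : MvPolynomial (Fin 4) ℝ} (hvh : v.IsHomogeneous L) (hvl : lap v = 0)
    (hv : ∀ q : MvPolynomial (Fin 4) ℝ, q.IsHomogeneous L → lap q = 0 →
      ∫ x in {x : E4 | a < ‖x‖ ∧ ‖x‖ < b}, toFun q x * g x = ∫ x in {x : E4 | a < ‖x‖ ∧ ‖x‖ < b}, toFun q x * toFun v x)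
    (T₁ T₂ T₃ : E4 ≃ₗᵢ[ℝ] E4) (hid : ∀ z : E4, g (T₁ z) + g (T₂ z) = g z + g (T₃ z)) (z : E4) :
    toFun v (T₁ z) + toFun v (T₂ z) = toFun v z + toFun v (T₃ z) := by
  set S : Set E4 := {x : E4 | a < ‖x‖ ∧ ‖x‖ < b} with hS
  have hSm : MeasurableSet S := (measurableSet_lt measurable_const measurable_norm).inter (measurableSet_lt measurable_norm measurable_const)
  -- the polynomial `u := v∘T₁ + v∘T₂ − v − v∘T₃`
  let lin : (E4 ≃ₗᵢ[ℝ] E4) → Fin 4 → MvPolynomial (Fin 4) ℝ := fun T i =>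
    ∑ j : Fin 4, (T (EuclideanSpace.single j (1 : ℝ))) i • (X j : MvPolynomial (Fin 4) ℝ)
  have lin_fun : ∀ (T : E4 ≃ₗᵢ[ℝ] E4) (y : E4), toFun (aeval (lin T) v) y = toFun v (T y) := fun T y => toFun_aevalIso T v y
  set u : MvPolynomial (Fin 4) ℝ := aeval (lin T₁) v + aeval (lin T₂) v - v - aeval (lin T₃) v with hu_def
  have hu_e : u = aeval (lin T₁) v + aeval (lin T₂) v + (-1 : ℝ) • v + (-1 : ℝ) • aeval (lin T₃) v := by
    rw [hu_def, neg_one_smul, neg_one_smul, sub_eq_add_neg, sub_eq_add_neg]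
  have hu_fun : ∀ y : E4, toFun u y = toFun v (T₁ y) + toFun v (T₂ y) - toFun v y - toFun v (T₃ y) := fun y => by
    rw [hu_e]
    simp only [toFun_add, toFun_smul, lin_fun]
    ring
  have huh : u.IsHomogeneous L :=
    (((isHomogeneous_aevalIso T₁ hvh).add (isHomogeneous_aevalIso T₂ hvh)).sub hvh).sub (isHomogeneous_aevalIso T₃ hvh)
  have hla : ∀ T : E4 ≃ₗᵢ[ℝ] E4, lap (aeval (lin T) v) = 0 := fun T => lap_aevalIso_eq_zero T hvl
  have hul : lap u = 0 := by
    rw [hu_e, lap_add, lap_add, lap_add, lap_smul, lap_smul, hla T₁, hla T₂, hla T₃, hvl, smul_zero, add_zero, add_zero, add_zero]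
  -- integrability of the pieces
  have hgT : ∀ T : E4 ≃ₗᵢ[ℝ] E4, ContinuousOn (fun y => g (T y)) {0}ᶜ := fun T =>
    hgc.comp T.continuous.continuousOn fun y hy => by
      simp only [mem_compl_iff, mem_singleton_iff] at hy ⊢
      exact fun h0 => hy (T.map_eq_zero_iff.1 h0)
  have hIq : ∀ (q : MvPolynomial (Fin 4) ℝ) (T : E4 ≃ₗᵢ[ℝ] E4), IntegrableOn (fun y : E4 => toFun q y * g (T y)) S volume :=
    fun q T => integrableOn_toFun_mul (integrableOn_shell (hgT T) ha) q
  have hIq0 : ∀ q : MvPolynomial (Fin 4) ℝ, IntegrableOn (fun y : E4 => toFun q y * g y) S volume :=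
    fun q => integrableOn_toFun_mul (integrableOn_shell hgc ha) q
  have hIv : ∀ (q : MvPolynomial (Fin 4) ℝ) (T : E4 ≃ₗᵢ[ℝ] E4), IntegrableOn (fun y : E4 => toFun q y * toFun v (T y)) S volume :=
    fun q T => (integrableOn_toFun_mul_shell q (aeval (lin T) v) a b).congr_fun (fun y _ => by simp only [lin_fun]) hSm
  -- `u` is shell-orthogonal to `Harm_L`
  have horth : ∀ q : MvPolynomial (Fin 4) ℝ, q.IsHomogeneous L → lap q = 0 → ∫ y in S, toFun q y * toFun u y = 0 := by
    intro q hq hlq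
    have e1 := harmonicProjection_comp_iso hv T₁ hq hlq
    have e2 := harmonicProjection_comp_iso hv T₂ hq hlq
    have e3 := harmonicProjection_comp_iso hv T₃ hq hlq
    have e0 := hv q hq hlq
    -- `∫ q·u = (∫ q v∘T₁ + ∫ q v∘T₂ − ∫ q v) − ∫ q v∘T₃ = (∫ q g∘T₁ + ∫ q g∘T₂ − ∫ q g) − ∫ q g∘T₃ = ∫ q·0`
    have hv0 := integrableOn_toFun_mul_shell q v a b
    have esplit : ∫ y in S, toFun q y * toFun u y =
        (((∫ y in S, toFun q y * toFun v (T₁ y)) + ∫ y in S, toFun q y * toFun v (T₂ y)) - ∫ y in S, toFun q y * toFun v y) -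
          ∫ y in S, toFun q y * toFun v (T₃ y) := by
      rw [show (fun y : E4 => toFun q y * toFun u y) = fun y =>
          ((toFun q y * toFun v (T₁ y) + toFun q y * toFun v (T₂ y)) - toFun q y * toFun v y) - toFun q y * toFun v (T₃ y) from
        funext fun y => by rw [hu_fun]; ring]
      have i12 : Integrable (fun y : E4 => toFun q y * toFun v (T₁ y) + toFun q y * toFun v (T₂ y)) (volume.restrict S) :=
        (hIv q T₁).add (hIv q T₂)
      have i123 : Integrable (fun y : E4 => (toFun q y * toFun v (T₁ y) + toFun q y * toFun v (T₂ y)) - toFun q y * toFun v y)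
          (volume.restrict S) := i12.sub hv0
      rw [integral_sub i123 (hIv q T₃), integral_sub i12 hv0, integral_add (hIv q T₁) (hIv q T₂)]
    have ecomb : (((∫ y in S, toFun q y * g (T₁ y)) + ∫ y in S, toFun q y * g (T₂ y)) - ∫ y in S, toFun q y * g y) -
        ∫ y in S, toFun q y * g (T₃ y) = 0 := by
      have j12 : Integrable (fun y : E4 => toFun q y * g (T₁ y) + toFun q y * g (T₂ y)) (volume.restrict S) :=
        (hIq q T₁).add (hIq q T₂)
      have j123 : Integrable (fun y : E4 => (toFun q y * g (T₁ y) + toFun q y * g (T₂ y)) - toFun q y * g y)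
          (volume.restrict S) := j12.sub (hIq0 q)
      rw [← integral_add (hIq q T₁) (hIq q T₂), ← integral_sub j12 (hIq0 q), ← integral_sub j123 (hIq q T₃)]
      refine (integral_congr_ae (ae_of_all _ fun y => ?_)).trans (integral_zero _ _)
      have h := hid y
      calc toFun q y * g (T₁ y) + toFun q y * g (T₂ y) - toFun q y * g y - toFun q y * g (T₃ y)
          = toFun q y * (g (T₁ y) + g (T₂ y) - (g y + g (T₃ y))) := by ring
        _ = 0 := by rw [h, sub_self, mul_zero]
    rw [esplit, ← e1, ← e2, ← e3, ← e0]
    exact ecomb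
  have hzero := eq_zero_of_shell_orthogonal huh hul ha hab horth
  have h := hu_fun z
  rw [hzero, toFun_zero] at h
  linarith

/-! ## The analytic half, unfolded -/

/-- **R-O1 «ANALYTIC HALF», unfolded, for an arbitrary symmetry family.**  Let `𝒢` be any set of linear isometries of `ℝ⁴`.  If every
harmonic homogeneous polynomial that is `𝒢`-invariant and even-part slice-invariant is `O(4)`-invariant, then every kernel continuous off
the origin, `𝒢`-invariant and even-part slice-invariant is `O(4)`-invariant.  (The degree-wise shell projection inherits every isometry
invariance of `K` and the slice identity; no analyticity is used.) -/
theorem isometry_invariant_of_noBadModes_family (𝒢 : Set (E4 ≃ₗᵢ[ℝ] E4))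
    (hNB : ∀ (L : ℕ) (h : MvPolynomial (Fin 4) ℝ), h.IsHomogeneous L → lap h = 0 →
      (∀ A ∈ 𝒢, ∀ x : E4, toFun h (A x) = toFun h x) →
      EvenPartSliceInvariant (toFun h) → ∀ (R : E4 ≃ₗᵢ[ℝ] E4) (x : E4), toFun h (R x) = toFun h x)
    {K : E4 → ℝ} (hKc : ContinuousOn K {x | x ≠ 0}) (hKs : ∀ A ∈ 𝒢, ∀ x : E4, K (A x) = K x)
    (hKe : EvenPartSliceInvariant K) (R : E4 ≃ₗᵢ[ℝ] E4) (x : E4) : K (R x) = K x := by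
  by_cases hx : x = 0
  · rw [hx, map_zero]
  have hset : ({0}ᶜ : Set E4) = {x | x ≠ 0} := by ext; simp
  have hKc' : ContinuousOn K {0}ᶜ := by rw [hset]; exact hKc
  have hKT : ∀ T : E4 ≃ₗᵢ[ℝ] E4, ContinuousOn (fun y => K (T y)) {0}ᶜ := fun T =>
    hKc'.comp T.continuous.continuousOn fun y hy => by
      simp only [mem_compl_iff, mem_singleton_iff] at hy ⊢
      exact fun h0 => hy (T.map_eq_zero_iff.1 h0)
  set F : E4 → ℝ := fun z => K (R z) - K z with hF
  have hFc : ContinuousOn F {0}ᶜ := (hKT R).sub hKc'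
  -- all shell moments of `F` against harmonic homogeneous polynomials vanish
  have hmom : ∀ (L : ℕ) (q : MvPolynomial (Fin 4) ℝ), q.IsHomogeneous L → lap q = 0 → ∀ a b : ℝ, 0 < a → a < b →
      ∫ y in {y : E4 | a < ‖y‖ ∧ ‖y‖ < b}, F y * toFun q y = 0 := by
    intro L q hq hlq a b ha hab
    set S : Set E4 := {y : E4 | a < ‖y‖ ∧ ‖y‖ < b} with hS
    have hSm : MeasurableSet S :=
      (measurableSet_lt measurable_const measurable_norm).inter (measurableSet_lt measurable_norm measurable_const)
    obtain ⟨v, hvh, hvl, hv⟩ := exists_harmonicProjection ha hab (integrableOn_shell hKc' ha) L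
    -- the projection is `O(4)`-invariant by `NoBadModes L`
    have hvinv : ∀ (A : E4 ≃ₗᵢ[ℝ] E4) (z : E4), toFun v (A z) = toFun v z := by
      refine hNB L v hvh hvl (fun A hA z => harmonicProjection_invariant ha hab hvh hvl hv A (hKs A hA) z) ?_
      intro R₂ y w
      obtain ⟨Tp, Tm, N, hTp, hTm, hN, hKid⟩ := evenPartSliceInvariant_pointwise hKe R₂
      have h := harmonicProjection_identity hKc' ha hab hvh hvl hv Tp Tm N hKid (planeEmb y + perpEmb w)
      rw [hTp, hTm, hN] at h
      exact h
    -- hence `∫_S q·(K∘R) = ∫_S q·(v∘R) = ∫_S q·v = ∫_S q·K`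
    have e1 := harmonicProjection_comp_iso hv R hq hlq
    simp_rw [hvinv R] at e1
    rw [← hv q hq hlq] at e1
    have hI1 : IntegrableOn (fun y : E4 => toFun q y * K (R y)) S volume := integrableOn_toFun_mul (integrableOn_shell (hKT R) ha) q
    have hI2 : IntegrableOn (fun y : E4 => toFun q y * K y) S volume := integrableOn_toFun_mul (integrableOn_shell hKc' ha) q
    calc ∫ y in S, F y * toFun q y = ∫ y in S, (toFun q y * K (R y) - toFun q y * K y) :=
          integral_congr_ae (ae_of_all _ fun y => by simp only [hF]; ring)
      _ = (∫ y in S, toFun q y * K (R y)) - ∫ y in S, toFun q y * K y := integral_sub hI1 hI2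
      _ = 0 := by rw [e1, sub_self]
  -- pass to the sphere through `x`
  have hr : 0 < ‖x‖ := norm_pos_iff.2 hx
  set f : E4 → ℝ := fun z => F (‖x‖ • z) with hf
  have hfc : ContinuousOn f {0}ᶜ := hFc.comp (continuous_const_smul ‖x‖).continuousOn fun z hz => by
    simp only [mem_compl_iff, mem_singleton_iff] at hz ⊢
    exact smul_ne_zero hr.ne' hz
  have horth : ∀ (L : ℕ) (P : MvPolynomial (Fin 4) ℝ), 1 ≤ L → P.IsHomogeneous L → lap P = 0 →
      ∫ α, toFun P (α : E4) * f α ∂(volume : Measure E4).toSphere = 0 := fun L P _ hP hlP =>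
    sphere_moment_eq_zero_of_shell_integrals hFc hP (fun a b ha hab => hmom L P hP hlP a b ha hab) hr
  have hconst := const_on_sphere_of_orthogonal_harmonics hfc horth
  -- the mean of `f` vanishes (degree-`0` moment)
  have hmean : ∫ α, f α ∂(volume : Measure E4).toSphere = 0 := by
    have h1 : (C (1 : ℝ) : MvPolynomial (Fin 4) ℝ).IsHomogeneous 0 := MvPolynomial.isHomogeneous_C _ _
    have h := sphere_moment_eq_zero_of_shell_integrals hFc h1
      (fun a b ha hab => hmom 0 (C 1) h1 (lap_eq_zero_of_isHomogeneous_le_one h1 (Nat.zero_le 1)) a b ha hab) hr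
    have e : ∀ α : E4, toFun (C (1 : ℝ) : MvPolynomial (Fin 4) ℝ) α = 1 := fun α => toFun_C 1 α
    simp_rw [e, one_mul] at h
    exact h
  -- a constant with zero mean on `S³` is zero
  set u₀ : E4 := ‖x‖⁻¹ • x with hu₀
  have hu₀n : ‖u₀‖ = 1 := by rw [hu₀, norm_smul, norm_inv, norm_norm, inv_mul_cancel₀ hr.ne']
  have hcf : ∀ α : sphere (0 : E4) 1, f α = f u₀ := fun α => hconst α u₀ (norm_eq_of_mem_sphere α) hu₀n
  have hval : f u₀ = 0 := by
    have h : ∫ α, f α ∂(volume : Measure E4).toSphere = ∫ _α : sphere (0 : E4) 1, f u₀ ∂(volume : Measure E4).toSphere :=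
      integral_congr_ae (ae_of_all _ fun α => hcf α)
    rw [hmean, integral_const, smul_eq_mul, measureReal_def] at h
    exact (mul_eq_zero.1 h.symm).resolve_left sphere_measure_toReal_pos.ne'
  have hxu : ‖x‖ • u₀ = x := by rw [hu₀, smul_smul, mul_inv_cancel₀ hr.ne', one_smul]
  have hFx : F x = 0 := by rw [← hxu]; exact hval
  simp only [hF] at hFx
  linarith

/-- **R-O1 «ANALYTIC HALF», unfolded** (the typed hypothesis `∀ L, NoBadModes L` with `pev = toFun`, `Σ∂ᵢ∂ᵢ = lap`): if every harmonic
homogeneous polynomial on `ℝ⁴` that is signed-permutation invariant and even-part slice-invariant is `O(4)`-invariant, then every kernel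
continuous off the origin, signed-permutation invariant and even-part slice-invariant is `O(4)`-invariant. -/
theorem isometry_invariant_of_noBadModes
    (hNB : ∀ (L : ℕ) (h : MvPolynomial (Fin 4) ℝ), h.IsHomogeneous L → lap h = 0 →
      (∀ R : E4 ≃ₗᵢ[ℝ] E4, IsSignedPerm R → ∀ x : E4, toFun h (R x) = toFun h x) →
      EvenPartSliceInvariant (toFun h) → ∀ (R : E4 ≃ₗᵢ[ℝ] E4) (x : E4), toFun h (R x) = toFun h x)
    {K : E4 → ℝ} (hKc : ContinuousOn K {x | x ≠ 0}) (hKs : ∀ R : E4 ≃ₗᵢ[ℝ] E4, IsSignedPerm R → ∀ x : E4, K (R x) = K x)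
    (hKe : EvenPartSliceInvariant K) (R : E4 ≃ₗᵢ[ℝ] E4) (x : E4) : K (R x) = K x :=
  isometry_invariant_of_noBadModes_family {A | IsSignedPerm A} (fun L h hh hl hs he => hNB L h hh hl (fun A hA => hs A hA) he)
    hKc (fun A hA => hKs A hA) hKe R x

/-- **The same with the full symmetry of the class passed down** (signed permutations AND the isometries preserving the checkerboard
lattice `D₄`, i.e. conjuncts 3 and 6 of `InClass`): a WEAKER polynomial hypothesis — bad modes need only be excluded among
`W(F₄)`-invariant harmonics — with the same conclusion.  Offered to the planners as an alternative door to `OddModeRigidity`. -/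
theorem isometry_invariant_of_noBadModes_F4
    (hNB : ∀ (L : ℕ) (h : MvPolynomial (Fin 4) ℝ), h.IsHomogeneous L → lap h = 0 →
      (∀ R : E4 ≃ₗᵢ[ℝ] E4, IsSignedPerm R → ∀ x : E4, toFun h (R x) = toFun h x) →
      (∀ R : E4 ≃ₗᵢ[ℝ] E4,
        (∀ z : Fin 4 → ℤ, Even (∑ i, z i) → ∃ w : Fin 4 → ℤ, Even (∑ i, w i) ∧ R (siteToE z) = siteToE w) →
        ∀ x : E4, toFun h (R x) = toFun h x) →
      EvenPartSliceInvariant (toFun h) → ∀ (R : E4 ≃ₗᵢ[ℝ] E4) (x : E4), toFun h (R x) = toFun h x)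
    {K : E4 → ℝ} (hKc : ContinuousOn K {x | x ≠ 0}) (hKs : ∀ R : E4 ≃ₗᵢ[ℝ] E4, IsSignedPerm R → ∀ x : E4, K (R x) = K x)
    (hKl : ∀ R : E4 ≃ₗᵢ[ℝ] E4,
      (∀ z : Fin 4 → ℤ, Even (∑ i, z i) → ∃ w : Fin 4 → ℤ, Even (∑ i, w i) ∧ R (siteToE z) = siteToE w) → ∀ x : E4, K (R x) = K x)
    (hKe : EvenPartSliceInvariant K) (R : E4 ≃ₗᵢ[ℝ] E4) (x : E4) : K (R x) = K x :=
  isometry_invariant_of_noBadModes_family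
    ({A | IsSignedPerm A} ∪
      {A | ∀ z : Fin 4 → ℤ, Even (∑ i, z i) → ∃ w : Fin 4 → ℤ, Even (∑ i, w i) ∧ A (siteToE z) = siteToE w})
    (fun L h hh hl hs he => hNB L h hh hl (fun A hA => hs A (Or.inl hA)) (fun A hA => hs A (Or.inr hA)) he)
    hKc (fun A hA => hA.elim (fun h1 => hKs A h1) (fun h2 => hKl A h2)) hKe R x

end Summit.QuantumFields.YangMills.Theorems.F4SubCurvatureDoorAnalyticHalfProof

end
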